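import Literature.NumberTheory.Rogawski1990.ExplicitFactorAlmostEverywhereTrivialTauWeyl
import Literature.NumberTheory.Rogawski1990.FinExplicitTransferFactorKappaEigenvector
import Literature.NumberTheory.Automorphic.QuadraticLocalUnramifiedUnitNorm
import Literature.NumberTheory.Automorphic.QuadraticAdeleBaseChange
import Literature.NumberTheory.Automorphic.UnitaryGroupLocalFactors
import Literature.NumberTheory.GaloisRepresentations.FrobeniusDensityTheorem
import Literature.LinearAlgebra.Matrix.EigenlineProjectorSelfAdjoint
import HarnessLib

/-!
# `κ_v(γ_H, γ̄_v) = +1` for almost all `v`: the finite explicit transfer factor's sign at an ADELIC matching element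
# (T6 node N3, FILE C of `F0/P3a/T6b-TREE.md` §9 — the `hκ` event of ★ `isAlmostEverywhereTrivial_finExplicitCollection_of_eventually_finKappaAt`)

Topic `NumberTheory/Rogawski1990`; namespace `Literature.NumberTheory.Rogawski1990`.  THEOREMS ONLY (no `def`, no named fact, no `sorry`, no
instance, no notation).  Cell `pub/hodgecm-mathlib`, F0∕P3a, topic T6 (#72 pay-down), DESK TABLE #3 row (4) N3; FILE C was planned by A-p16 (g22)
(FILE A ★ p828127 `ExplicitFactorAlmostEverywhereTrivialTauWeyl`, FILE B ★ p827910 `RankOneHermitianColumnNorm`, §1 ★ `EigenlineProjectorSelfAdjoint`;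
blueprint `A-provers/HANDOFF.md` § A-p16 (g22)) and is typed by F0P3a-p01 (g7) over its own ★ `FinExplicitTransferFactorKappaEigenvector` (p827970) and
★ `QuadraticLocalUnramifiedUnitNorm` (p828161).  HONEST LABEL: HC_CM is proved only modulo the printed citations («named inputs remaining 2») until
rung 0 closes; this file proves nothing of them.

THE MATHEMATICS [Rogawski1990 §14.6 p. 242 «`κ(γ, ψ_v(i(γ)))` … is `+1` for almost all `v`»; §4.3 p. 44 «`Δ_𝐀(γ_H, γ̄) = ∏_v Δ_v = 1` for a.a.
`v`»; Kottwitz1986 §7 (hyperspecial integrality)].  Let `γ_H ∈ H(L⁺)` be rational and `G`-regular and `γ̄ ∈ G′(𝔸) = U(H′)(𝔸_{L⁺})` adelic with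
`ι_v(γ_H) ↔ γ̄_v` at every finite `v`.  The sign `κ_v = ★ finKappaAt` of the explicit factor `Δ‴_v` (★ `FinExplicitTransferFactor`) is `+1` at a SPLIT `v`
as soon as `P_v = χ_g(γ̄_v) ≠ 0` (★ `finKappaAt_of_not_subsingleton`; `P_v ≠ 0` on `G`-regular matching pairs, ★ `finEigenlineProjector_ne_zero`); at a
NON-SPLIT `v` it is the unit-norm test on the `H′_v`-value of a `u`-eigenvector of `γ̄_v` (★ `finKappaAt_eq_one_of_eigenvector_of_exists`: any
non-zero eigenvector, e.g. a non-zero column of `P_v`, ★ `localMatrix_mulVec_finEigenlineProjector_col`).  For all but finitely many `v`: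
`v` is unramified in `L∕L⁺`, `γ̄_v ∈ GL₃(∏_{w∣v} 𝒪_w)`, `H′` and `H′⁻¹` are `w`-integral, `tr g`, `det g` are `w`-integral and `χ_g(u)` is a
`w`-unit (`G`-regularity: `χ_g(u) ≠ 0` in `L`).  At such a non-split `v`, with `w` the place above `v` and `σ_w` the conjugation of `L_w`:
`P_w := (P_v)_w` is integral with `P_w² = χ_g(u) P_w` (rank one, ★ `finEigenlineProjector_eq_vecMulVec_of_isLocalNormPair` + ★
`mul_self_eq_trace_smul_of_eq_vecMulVec` + ★ `trace_finEigenlineProjector_of_isLocalNormPair`), `tr P_w = χ_g(u)`, and SELF-ADJOINT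
`P_wᴴ H′_w P_w = σ(χ_g(u))·H′_w P_w` (★ `conjTranspose_mul_form_mul_eq_smul_of_unitary`: `γ̄_v` unitary, `γ̄_v P_v = u P_v` ★
`localMatrix_mul_finEigenlineProjector`, `σ(u)u = 1`); so the LOCAL KERNEL ★ `exists_norm_mul_unit_eq_conjTranspose_mul_mul_apply` (FILE B) gives a
column `j₀` with `H′_w(P e_{j₀}, P e_{j₀}) = z σ_w(z) · e`, `z ≠ 0`, `e` a `σ_w`-fixed unit; a `σ`-fixed unit of `L_w` is a unit norm at an unramified
place (★ `exists_isUnit_eq_mul_conjLocal_complexConj_of_isUnramifiedIn`, O'Meara 63:16), hence the test passes and `κ_v = +1`.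
* §0 bookkeeping (pushing matrices along ring maps).
* §1 the three matching-pair identities in `E_v = ∏_{w∣v} L_w` (any local matching pair): `σ(u)·u = 1`, `P_v² = χ_g(u)·P_v`, `P_vᴴ H′_v P_v = σ(χ_g(u))·H′_v P_v`.
* §2 the non-split place: reading at the unique `w ∣ v` (`(c⊗1 x)_w = σ_w(x_w)`, lift from `L_w` back to `E_v`).
* §3 **`finKappaAt_eq_one_of_integral_nonsplit`** — `κ_v = +1` at a non-split unramified `v` under the integrality ∕ unit hypotheses (any local matching pair).
* §4 **`eventually_finKappaAt_rationalComponent_eq_one (hherm) (hdet) (γH) (γ̄) (hreg) (hmatch)`** — the cofinite packaging for a rational `G`-regular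
  `γ_H` and an adelic `γ̄`; and the N3 CLOSER **`isAlmostEverywhereTrivial_finExplicitCollection (hherm) (hdet) (μ) (hl) (hr)`** = ★ FILE A's reduction ∘ §4.

## References
* [Rogawski1990] J. D. Rogawski, *Automorphic Representations of Unitary Groups in Three Variables*, Ann. of Math. Stud. 123 (1990): §4.3 pp. 43–44
  (`Δ_𝐀 = ∏_v Δ_v`, «`= 1` for almost all `v`»), §4.9 p. 55 (`Δ_{G∕H}`, `Φ^κ`), §3.5 Prop. 3.5.2 (c) p. 29, §14.6 p. 242 («`+1` for almost all `v`»).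
* [Kottwitz1986] R. E. Kottwitz, *Stable trace formula: elliptic singular terms*, Math. Ann. 275 (1986), §7.
* [Omeara1963] O. T. O'Meara, *Introduction to Quadratic Forms* (1963), §63C Example 63:16.
-/

set_option autoImplicit false

noncomputable section

open NumberField IsDedekindDomain Filter Matrix Polynomial
open Literature.NumberTheory.GaloisRepresentations
open scoped MatrixGroups

namespace Literature.NumberTheory.Rogawski1990

open Literature.NumberTheory.Automorphic

/-! ## §0 Bookkeeping: matrices along ring homomorphisms -/

section Bookkeeping

variable {R S : Type*} [CommRing R] [CommRing S] (f : R →+* S)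

/-- The trace of a pushed-forward matrix. [folklore] -/
private theorem trace_map_ringHom' {n : Type*} [Fintype n] (M : Matrix n n R) : (M.map f).trace = f M.trace := by
  simp only [Matrix.trace, Matrix.diag_apply, Matrix.map_apply, map_sum]

/-- The determinant of a pushed-forward matrix (Mathlib `RingHom.map_det`). [folklore] -/
private theorem det_map_ringHom' {n : Type*} [Fintype n] [DecidableEq n] (M : Matrix n n R) : (M.map f).det = f M.det := by
  rw [RingHom.map_det, RingHom.mapMatrix_apply]

/-- The projector polynomial commutes with pushing forward. [folklore] -/
private theorem map_projector' {n : Type*} [Fintype n] [DecidableEq n] (X : Matrix n n R) (t d : R) :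
    (X * X - t • X + d • (1 : Matrix n n R)).map f = X.map f * X.map f - f t • X.map f + f d • (1 : Matrix n n S) := by
  ext i j
  simp only [Matrix.map_apply, Matrix.add_apply, Matrix.sub_apply, Matrix.smul_apply, Matrix.mul_apply, Matrix.one_apply, smul_eq_mul,
    map_add, map_sub, map_mul, map_sum]
  split_ifs <;> simp

/-- A scalar multiple pushed forward. [folklore] -/
private theorem map_smul_ringHom' {m n : Type*} (c : R) (M : Matrix m n R) : (c • M).map f = f c • M.map f := by
  ext i j
  simp only [Matrix.map_apply, Matrix.smul_apply, smul_eq_mul, map_mul]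

/-- `(M.map σ)ᵀ.map f = ((M.map f).map σ')ᵀ` when `f ∘ σ = σ' ∘ f`. [folklore] -/
private theorem map_transpose_map_of_comm {m : Type*} (σ : R →+* R) (σ' : S →+* S) (hσ : ∀ x, f (σ x) = σ' (f x)) (M : Matrix m m R) :
    ((M.map σ)ᵀ).map f = ((M.map f).map σ')ᵀ := by
  ext i j
  simp only [Matrix.map_apply, Matrix.transpose_apply, hσ]

end Bookkeeping

/-! ## §1 The matching-pair identities in `E_v = ∏_{w ∣ v} L_w` -/

section Identities

variable (L : Type) [Field L] [NumberField L] [IsCMField L] (v : HeightOneSpectrum (𝓞 ↥(maximalRealSubfield L)))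
  (H' : Matrix (Fin 3) (Fin 3) L)
  (a : (UnitaryGroup.cmDatum L 2 (Matrix.of fun i j : Fin 2 => if i.val + j.val + 1 = 2 then (1 : L) else 0)).Local v ×
      (UnitaryGroup.cmDatum L 1 (Matrix.of fun i j : Fin 1 => if i.val + j.val + 1 = 1 then (1 : L) else 0)).Local v)
  (b : (UnitaryGroup.cmDatum L 3 H').Local v)

omit [IsCMField L] in
/-- The local form of `Φ₁ = (1)` is `(1)`: its `(0,0)` entry is `1`. [cite: Rogawski1990, §4.8 Case (a) p. 53] -/
private theorem localFormOne_apply :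
    UnitaryGroup.adeleToLocal L v (UnitaryGroup.adelicForm L 1 (Matrix.of fun i j : Fin 1 => if i.val + j.val + 1 = 1 then (1 : L) else 0) 0 0) = 1 := by
  rw [UnitaryGroup.adelicForm, Matrix.map_apply, Matrix.of_apply]
  simp

/-- **`σ(u) · u = 1`** for the `U(Φ₁)`-coordinate `u = γ₂` of `γ_H ∈ H_v` (membership in the `1 × 1` unitary group of the form `(1)`).
[cite: Rogawski1990, §4.8 Case (a) p. 53; §4.9 p. 55] -/
theorem conjLocal_finGammaTwo_mul_finGammaTwo :
    UnitaryGroup.conjLocal L (IsCMField.complexConj L) v (finGammaTwo L v a) * finGammaTwo L v a = 1 := by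
  have hmem : ((a.2.val.val : Matrix (Fin 1) (Fin 1) (UnitaryGroup.LocalRing L v)).map
        (UnitaryGroup.conjLocal L (IsCMField.complexConj L) v))ᵀ *
      (UnitaryGroup.adelicForm L 1 (Matrix.of fun i j : Fin 1 => if i.val + j.val + 1 = 1 then (1 : L) else 0)).map (UnitaryGroup.adeleToLocal L v) *
      (a.2.val.val : Matrix (Fin 1) (Fin 1) (UnitaryGroup.LocalRing L v)) =
      (UnitaryGroup.adelicForm L 1 (Matrix.of fun i j : Fin 1 => if i.val + j.val + 1 = 1 then (1 : L) else 0)).map (UnitaryGroup.adeleToLocal L v) :=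
    mem_unitaryGroupOfForm_iff.mp a.2.2
  have h00 := congrFun (congrFun hmem 0) 0
  simp only [Matrix.mul_apply, Fin.sum_univ_one, Matrix.transpose_apply, Matrix.map_apply, localFormOne_apply, mul_one] at h00
  exact h00

/-- **`P_v² = χ_g(u) · P_v`** on a matching pair (rank one: `P_v = p qᵀ`, `P_v² = tr(P_v)·P_v`, `tr P_v = χ_g(u)`).
[cite: Rogawski1990, §4.9 p. 55; §3.5 Prop. 3.5.2 (c) p. 29] -/
theorem finEigenlineProjector_mul_self (h : IsLocalNormPair L H' v a b) :
    finEigenlineProjector L v H' a b * finEigenlineProjector L v H' a b =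
      ((finCharpolyTwo L v a).eval (finGammaTwo L v a)) • finEigenlineProjector L v H' a b := by
  obtain ⟨p, q, hpq⟩ := finEigenlineProjector_eq_vecMulVec_of_isLocalNormPair L v H' a b h
  rw [Literature.LinearAlgebra.Matrix.mul_self_eq_trace_smul_of_eq_vecMulVec hpq, trace_finEigenlineProjector_of_isLocalNormPair L v H' a b h]

/-- **Self-adjointness: `P_vᴴ · H′_v · P_v = σ(χ_g(u)) · (H′_v · P_v)`** on a matching pair (`γ̄_v` is `H′_v`-unitary, `γ̄_v P_v = u P_v`, `σ(u) u = 1`;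
★ `conjTranspose_mul_form_mul_eq_smul_of_unitary`) — the `u`-eigenline of `γ̄_v` is `H′_v`-orthogonal to the other two. [cite: Rogawski1990, §4.3 pp. 42–44; §4.9 p. 55] -/
theorem finEigenlineProjector_selfAdjoint (h : IsLocalNormPair L H' v a b) :
    ((finEigenlineProjector L v H' a b).map (UnitaryGroup.conjLocal L (IsCMField.complexConj L) v))ᵀ *
        (UnitaryGroup.adelicForm L 3 H').map (UnitaryGroup.adeleToLocal L v) * finEigenlineProjector L v H' a b =
      UnitaryGroup.conjLocal L (IsCMField.complexConj L) v ((finCharpolyTwo L v a).eval (finGammaTwo L v a)) •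
        ((UnitaryGroup.adelicForm L 3 H').map (UnitaryGroup.adeleToLocal L v) * finEigenlineProjector L v H' a b) := by
  rw [eval_finCharpolyTwo_finGammaTwo]
  exact Literature.LinearAlgebra.Matrix.conjTranspose_mul_form_mul_eq_smul_of_unitary (UnitaryGroup.conjLocal L (IsCMField.complexConj L) v)
    (map_conjLocal_transpose_mul_localForm_mul L v H' b) rfl (localMatrix_mul_finEigenlineProjector L v H' a b h)
    (conjLocal_finGammaTwo_mul_finGammaTwo L v a)

end Identities

/-! ## §2 Reading at the unique place above a non-split `v` -/

section Nonsplit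

variable (L : Type) [Field L] [NumberField L] [IsCMField L] (v : HeightOneSpectrum (𝓞 ↥(maximalRealSubfield L)))

omit [IsCMField L] in
/-- At a non-split `v` (one place above `v`) every place `w ∣ v` is fixed by the Galois group element `c`. [cite: CasselsFrohlichANT1967, Ch. VII Prop. 1.2 (ii)] -/
theorem smul_placesOver_eq_of_subsingleton (c : L ≃ₐ[↥(maximalRealSubfield L)] L) (hv : Subsingleton (UnitaryGroup.PlacesOver L v))
    (w : UnitaryGroup.PlacesOver L v) : c • w.1 = w.1 := by
  have h : (⟨c • w.1, by rw [HeightOneSpectrum.under_algEquiv_smul]; exact w.2⟩ : UnitaryGroup.PlacesOver L v) = w :=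
    Subsingleton.elim _ _
  exact congrArg Subtype.val h

/-- Transport of a `w₁`-component along `c` read at a `c`-fixed place `w` (there `w₁ = w`). [cite: CasselsFrohlichANT1967, Ch. VII §1.1] -/
private theorem galAdicCompletionMap_apply_eq (w : UnitaryGroup.PlacesOver L v) (hw : IsCMField.complexConj L • w.1 = w.1)
    (w₁ : UnitaryGroup.PlacesOver L v) (h₁ : IsCMField.complexConj L • w₁.1 = w.1) (y : UnitaryGroup.LocalRing L v) :
    galAdicCompletionMap (L := L) (IsCMField.complexConj L) h₁ (y w₁) = galAdicCompletionMap (L := L) (IsCMField.complexConj L) hw (y w) := by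
  obtain rfl : w₁ = w := UnitaryGroup.PlacesOver.eq_of_smul_eq (IsCMField.complexConj L) (IsCMField.complexConj_ne_one L) w hw w₁
  rfl

/-- **`(c ⊗ 1) x` read at a `c`-fixed place `w` is `σ_w(x_w)`**, `σ_w = galAdicCompletionMap c` the conjugation of `L_w` (the tree's ★
`conjLocal_apply_eq_of_smul_eq`, restated to keep this file's imports light). [cite: CasselsFrohlichANT1967, Ch. VII §1.1] -/
theorem conjLocal_apply_eq_galAdicCompletionMap (w : UnitaryGroup.PlacesOver L v) (hw : IsCMField.complexConj L • w.1 = w.1)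
    (x : UnitaryGroup.LocalRing L v) :
    UnitaryGroup.conjLocal L (IsCMField.complexConj L) v x w = galAdicCompletionMap (L := L) (IsCMField.complexConj L) hw (x w) := by
  rw [UnitaryGroup.conjLocal_apply]
  exact galAdicCompletionMap_apply_eq L v w hw ⟨(IsCMField.complexConj L)⁻¹ • w.1, UnitaryGroup.under_inv_smul_eq (IsCMField.complexConj L) w⟩
    (smul_inv_smul (IsCMField.complexConj L) w.1) x

/-- `σ_w` is an involution of `L_w` (`c² = 1`). [cite: CasselsFrohlichANT1967, Ch. VII §1.1] -/
theorem galAdicCompletionMap_complexConj_self (w : UnitaryGroup.PlacesOver L v) (hw : IsCMField.complexConj L • w.1 = w.1)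
    (y : w.1.adicCompletion L) :
    galAdicCompletionMap (L := L) (IsCMField.complexConj L) hw (galAdicCompletionMap (L := L) (IsCMField.complexConj L) hw y) = y := by
  have hcc : IsCMField.complexConj L * IsCMField.complexConj L = 1 := by
    ext x
    exact IsCMField.complexConj_apply_apply L x
  rw [galAdicCompletionMap_galAdicCompletionMap L, galAdicCompletionMap_congr_left L hcc _ (one_smul _ w.1), galAdicCompletionMap_one]

/-- `σ_w` extends complex conjugation: `σ_w(a) = c(a)` for `a ∈ L`. [cite: CasselsFrohlichANT1967, Ch. VII §1.1] -/
theorem galAdicCompletionMap_complexConj_algebraMap (w : UnitaryGroup.PlacesOver L v) (hw : IsCMField.complexConj L • w.1 = w.1) (a : L) :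
    galAdicCompletionMap (L := L) (IsCMField.complexConj L) hw (algebraMap L (w.1.adicCompletion L) a) =
      algebraMap L (w.1.adicCompletion L) (cmConjRingHom L a) :=
  galAdicCompletionMap_coe_algEquiv (↥(maximalRealSubfield L)) (IsCMField.complexConj L) hw a

/-- A lift from `L_w` back to `∏_{w' ∣ v} L_{w'}` at a non-split `v`: the function equal to `k` at `w` (transported to the other — equal — indices).
[cite: CasselsFrohlichANT1967, Ch. II §10] -/
private theorem exists_localRing_apply_eq (w : UnitaryGroup.PlacesOver L v) (hw : IsCMField.complexConj L • w.1 = w.1) (k : w.1.adicCompletion L) :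
    ∃ x : UnitaryGroup.LocalRing L v, x w = k := by
  refine ⟨fun w' => cast (congrArg (fun u : UnitaryGroup.PlacesOver L v => u.1.adicCompletion L)
    (UnitaryGroup.PlacesOver.eq_of_smul_eq (IsCMField.complexConj L) (IsCMField.complexConj_ne_one L) w hw w').symm) k, ?_⟩
  exact cast_eq _ _

end Nonsplit

/-! ## §3 `κ_v = +1` at a good non-split place (any local matching pair) -/

section Local

variable (L : Type) [Field L] [NumberField L] [IsCMField L] (v : HeightOneSpectrum (𝓞 ↥(maximalRealSubfield L)))
  (H' : Matrix (Fin 3) (Fin 3) L)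
  (a : (UnitaryGroup.cmDatum L 2 (Matrix.of fun i j : Fin 2 => if i.val + j.val + 1 = 2 then (1 : L) else 0)).Local v ×
      (UnitaryGroup.cmDatum L 1 (Matrix.of fun i j : Fin 1 => if i.val + j.val + 1 = 1 then (1 : L) else 0)).Local v)
  (b : (UnitaryGroup.cmDatum L 3 H').Local v)

/-- **`κ_v(γ_H, γ′) = +1` AT A GOOD NON-SPLIT PLACE.**  Let `v` be non-split and unramified in `L∕L⁺`, `w` the place above it; `H′` hermitian and
invertible, `w`-integral with `w`-integral inverse; `ι_v(γ_H) ↔ γ′` with `γ′ ∈ GL₃(∏ 𝒪_w)`-integral entries, `tr g`, `det g` `w`-integral and `χ_g(u)` a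
`w`-unit.  Then the unit-norm test of ★ `finKappaAt` passes: `κ_v = 1`.  (FILE B's local kernel at `K = L_w` on `P_w = (P_v)_w`, whose hypotheses are
§1's identities read at `w`; the `σ_w`-fixed unit `e` it produces is a unit norm, ★ `exists_isUnit_eq_mul_conjLocal_complexConj_of_isUnramifiedIn`; then ★
`finKappaAt_eq_one_of_eigenvector_of_exists` on the column `P_v e_{j₀}`.) [cite: Rogawski1990, §14.6 p. 242; §4.3 p. 44] [cite: Kottwitz1986, §7] -/
theorem finKappaAt_eq_one_of_integral_nonsplit (hv : Subsingleton (UnitaryGroup.PlacesOver L v)) (w : UnitaryGroup.PlacesOver L v)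
    (hunr : Algebra.IsUnramifiedIn (𝓞 L) v.asIdeal) (hherm : (H'.map (cmConjRingHom L))ᵀ = H') (hdet : IsUnit H'.det)
    (h : IsLocalNormPair L H' v a b)
    (hHint : ∀ i j, Valued.v (algebraMap L (w.1.adicCompletion L) (H' i j)) ≤ 1)
    (hHinv : ∀ i j, Valued.v (algebraMap L (w.1.adicCompletion L) (H'⁻¹ i j)) ≤ 1)
    (hb : ∀ i j, Valued.v ((b.val.val : Matrix (Fin 3) (Fin 3) (UnitaryGroup.LocalRing L v)) i j w) ≤ 1)
    (hT : Valued.v ((a.1.val.val : Matrix (Fin 2) (Fin 2) (UnitaryGroup.LocalRing L v)).trace w) ≤ 1)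
    (hD : Valued.v ((a.1.val.val : Matrix (Fin 2) (Fin 2) (UnitaryGroup.LocalRing L v)).det w) ≤ 1)
    (hc : Valued.v (((finCharpolyTwo L v a).eval (finGammaTwo L v a)) w) = 1) :
    finKappaAt L v H' a b = 1 := by
  classical
  have hc1 : IsCMField.complexConj L ≠ 1 := IsCMField.complexConj_ne_one L
  have hw : IsCMField.complexConj L • w.1 = w.1 := smul_placesOver_eq_of_subsingleton L v (IsCMField.complexConj L) hv w
  -- notation
  set P := finEigenlineProjector L v H' a b with hPdef
  set Hv : Matrix (Fin 3) (Fin 3) (UnitaryGroup.LocalRing L v) := (UnitaryGroup.adelicForm L 3 H').map (UnitaryGroup.adeleToLocal L v) with hHvdef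
  set cχ : UnitaryGroup.LocalRing L v := (finCharpolyTwo L v a).eval (finGammaTwo L v a) with hcχdef
  let π : UnitaryGroup.LocalRing L v →+* w.1.adicCompletion L :=
    Pi.evalRingHom (fun w' : UnitaryGroup.PlacesOver L v => w'.1.adicCompletion L) w
  let σ : w.1.adicCompletion L →+* w.1.adicCompletion L := galAdicCompletionMap (L := L) (IsCMField.complexConj L) hw
  have hπ : ∀ x : UnitaryGroup.LocalRing L v, π x = x w := fun _ => rfl
  have hπσ : ∀ x : UnitaryGroup.LocalRing L v, π (UnitaryGroup.conjLocal L (IsCMField.complexConj L) v x) = σ (π x) := fun x =>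
    conjLocal_apply_eq_galAdicCompletionMap L v w hw x
  -- the `w`-matrices
  set Pw : Matrix (Fin 3) (Fin 3) (w.1.adicCompletion L) := P.map π with hPwdef
  set J : Matrix (Fin 3) (Fin 3) (w.1.adicCompletion L) := H'.map (algebraMap L (w.1.adicCompletion L)) with hJdef
  set Jinv : Matrix (Fin 3) (Fin 3) (w.1.adicCompletion L) := H'⁻¹.map (algebraMap L (w.1.adicCompletion L)) with hJinvdef
  have hHvπ : Hv.map π = J := UnitaryGroup.localForm_map_eval L 3 H' v w
  -- hypotheses of the local kernel
  have hσσ : ∀ x, σ (σ x) = x := galAdicCompletionMap_complexConj_self L v w hw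
  have hσv : ∀ x, Valued.v (σ x) = Valued.v x := fun x => valued_galAdicCompletionMap L (IsCMField.complexConj L) hw x
  have hJ : ∀ i j, Valued.v (J i j) ≤ 1 := fun i j => by rw [hJdef, Matrix.map_apply]; exact hHint i j
  have hJinv : ∀ i j, Valued.v (Jinv i j) ≤ 1 := fun i j => by rw [hJinvdef, Matrix.map_apply]; exact hHinv i j
  have hJJ : Jinv * J = 1 := by
    rw [hJinvdef, hJdef, ← Matrix.map_mul, Matrix.nonsing_inv_mul H' hdet,
      Matrix.map_one _ (map_zero _) (map_one _)]
  have hJh : (J.map σ)ᵀ = J :=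
    Literature.LinearAlgebra.Matrix.transpose_map_map_eq_of_transpose_map_eq (cmConjRingHom L) (algebraMap L (w.1.adicCompletion L)) σ
      (galAdicCompletionMap_complexConj_algebraMap L v w hw) hherm
  have hPw : Pw = (b.val.val : Matrix (Fin 3) (Fin 3) (UnitaryGroup.LocalRing L v)).map π *
      (b.val.val : Matrix (Fin 3) (Fin 3) (UnitaryGroup.LocalRing L v)).map π -
      π (a.1.val.val : Matrix (Fin 2) (Fin 2) (UnitaryGroup.LocalRing L v)).trace • (b.val.val : Matrix (Fin 3) (Fin 3) (UnitaryGroup.LocalRing L v)).map π +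
      π (a.1.val.val : Matrix (Fin 2) (Fin 2) (UnitaryGroup.LocalRing L v)).det • (1 : Matrix (Fin 3) (Fin 3) (w.1.adicCompletion L)) := by
    rw [hPwdef, hPdef]
    dsimp only [finEigenlineProjector]
    exact map_projector' π _ _ _
  have hPint : ∀ i j, Valued.v (Pw i j) ≤ 1 := fun i j => by
    rw [hPw]
    exact Literature.LinearAlgebra.Matrix.valuation_projector_apply_le_one Valued.v (fun i j => by rw [Matrix.map_apply]; exact hb i j) hT hD i j
  have hcw : Valued.v (π cχ) = 1 := hc
  have hPP : Pw * Pw = π cχ • Pw := by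
    have h1 := congrArg (fun M : Matrix (Fin 3) (Fin 3) (UnitaryGroup.LocalRing L v) => M.map π) (finEigenlineProjector_mul_self L v H' a b h)
    simpa only [Matrix.map_mul, map_smul_ringHom'] using h1
  have htr : Pw.trace = π cχ := by
    rw [hPwdef, trace_map_ringHom', hPdef, trace_finEigenlineProjector_of_isLocalNormPair L v H' a b h]
  have hsa : (Pw.map σ)ᵀ * J * Pw = σ (π cχ) • (J * Pw) := by
    have h1 := congrArg (fun M : Matrix (Fin 3) (Fin 3) (UnitaryGroup.LocalRing L v) => M.map π) (finEigenlineProjector_selfAdjoint L v H' a b h)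
    simp only [Matrix.map_mul, map_smul_ringHom', map_transpose_map_of_comm π _ σ hπσ] at h1
    rw [hHvπ, hπσ] at h1
    exact h1
  -- a column of `P_w` with unit diagonal entry
  obtain ⟨j₀, hj₀⟩ := Literature.LinearAlgebra.Matrix.exists_valuation_diag_eq_one Valued.v hPint hcw htr
  have hPw0 : Pw j₀ j₀ ≠ 0 := fun h0 => by
    rw [h0, map_zero] at hj₀
    exact zero_ne_one hj₀
  obtain ⟨z, e, hz, he1, hefix, hcol⟩ :=
    Literature.LinearAlgebra.Matrix.exists_norm_mul_unit_eq_conjTranspose_mul_mul_apply Valued.v σ hσσ hσv hJ hJinv hJJ hJh hPint hcw hPP htr hsa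
      ⟨j₀, hPw0⟩
  -- the hermitian value of the column `P e_{j₀}` in `E_v`, read at `w`
  set x₀ : UnitaryGroup.LocalRing L v :=
    ∑ i : Fin 3, ∑ k : Fin 3, UnitaryGroup.conjLocal L (IsCMField.complexConj L) v (P i j₀) * Hv i k * P k j₀ with hx₀def
  have hx₀w : π x₀ = z * σ z * e := by
    rw [hx₀def, ← hcol, Literature.LinearAlgebra.Matrix.conjTranspose_mul_mul_apply_eq_sum_sum, ← hHvπ, map_sum]
    refine Finset.sum_congr rfl fun i _ => ?_
    rw [map_sum]
    refine Finset.sum_congr rfl fun k _ => ?_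
    rw [map_mul, map_mul, hπσ]
    rfl
  -- lift `z`, `e` to `E_v`
  obtain ⟨Zl, hZl⟩ := exists_localRing_apply_eq L v w hw z
  obtain ⟨E, hE⟩ := exists_localRing_apply_eq L v w hw e
  have hEfix : UnitaryGroup.conjLocal L (IsCMField.complexConj L) v E = E := by
    refine (UnitaryGroup.LocalRing.eq_iff_apply_eq (IsCMField.complexConj L) hc1 w hw _ _).2 ?_
    rw [conjLocal_apply_eq_galAdicCompletionMap L v w hw, hE]
    exact hefix
  have hEunit : ∀ w' : UnitaryGroup.PlacesOver L v, Valued.v (E w') = 1 := by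
    intro w'
    obtain rfl : w' = w := UnitaryGroup.PlacesOver.eq_of_smul_eq (IsCMField.complexConj L) hc1 w hw w'
    rw [hE]
    exact he1
  obtain ⟨Z'', hZ''u, hEZ⟩ := UnitaryGroup.exists_isUnit_eq_mul_conjLocal_complexConj_of_isUnramifiedIn L v hunr hEfix hEunit
  have hZl0 : Zl ≠ 0 := fun h0 => hz (by rw [← hZl, h0]; rfl)
  have hZlu : IsUnit Zl := isUnit_localRing_of_ne_zero_of_subsingleton L v hv hZl0
  have hx₀ : x₀ = (Zl * Z'') * UnitaryGroup.conjLocal L (IsCMField.complexConj L) v (Zl * Z'') := by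
    refine (UnitaryGroup.LocalRing.eq_iff_apply_eq (IsCMField.complexConj L) hc1 w hw _ _).2 ?_
    have hEw : e = Z'' w * UnitaryGroup.conjLocal L (IsCMField.complexConj L) v Z'' w := by
      rw [← hE, hEZ]; rfl
    change π x₀ = _
    rw [hx₀w, Pi.mul_apply, Pi.mul_apply, map_mul, Pi.mul_apply, conjLocal_apply_eq_galAdicCompletionMap L v w hw Zl, hZl, hEw]
    ring
  -- the column is a non-zero `u`-eigenvector and `χ_g(u)` is a unit of `E_v`
  have hne : (fun i => P i j₀) ≠ 0 := by
    intro h0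
    apply hPw0
    have := congrFun h0 j₀
    rw [hPwdef, Matrix.map_apply]
    change π (P j₀ j₀) = 0
    rw [show P j₀ j₀ = 0 from this, map_zero]
  have hu : IsUnit cχ := by
    refine isUnit_localRing_of_ne_zero_of_subsingleton L v hv fun h0 => ?_
    rw [h0] at hcw
    change Valued.v ((0 : UnitaryGroup.LocalRing L v) w) = 1 at hcw
    rw [Pi.zero_apply, map_zero] at hcw
    exact zero_ne_one hcw
  exact finKappaAt_eq_one_of_eigenvector_of_exists L v H' a b hv h hu (localMatrix_mulVec_finEigenlineProjector_col L v H' a b h j₀) hne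
    ⟨Zl * Z'', hZlu.mul hZ''u, hx₀⟩

end Local

/-! ## §4 The cofinite packaging: rational `G`-regular `γ_H`, adelic `γ̄` -/

section Global

variable (L : Type) [Field L] [NumberField L] [IsCMField L] (H' : Matrix (Fin 3) (Fin 3) L)

omit [IsCMField L] in
/-- Every `e ∈ L` is `w`-integral for all but finitely many places `w` of `L`. [cite: CasselsFrohlichANT1967, Ch. II §10] -/
private theorem eventually_valued_algebraMap_le_one' (e : L) :
    ∀ᶠ w : HeightOneSpectrum (𝓞 L) in cofinite, Valued.v (algebraMap L (w.adicCompletion L) e) ≤ 1 := by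
  rcases eq_or_ne e 0 with rfl | he
  · exact Filter.Eventually.of_forall fun w => by rw [map_zero, map_zero]; exact zero_le
  · exact (UnitaryGroup.eventually_valued_algebraMap_eq_one L he).mono fun w hw => hw.le

/-- **`κ_v(γ_H, γ̄_v) = +1` FOR ALMOST ALL `v`** — for `H′` hermitian invertible, `γ_H ∈ H(L⁺)` rational and `G`-regular and `γ̄ ∈ U(H′)(𝔸_{L⁺})` adelic
with `ι_v(γ_H) ↔ γ̄_v` at every finite `v`: the sign `κ_v` of the explicit finite transfer factor (★ `finKappaAt`) is `+1` at all but finitely many `v`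
(split `v`: `P_v ≠ 0`; non-split unramified `v` with `γ̄_v`, `H′`, `H′⁻¹`, `tr g`, `det g` integral and `χ_g(u)` a unit: §3).  This is the `hκ` event of ★
`isAlmostEverywhereTrivial_finExplicitCollection_of_eventually_finKappaAt` — «`κ(γ, ψ_v(i(γ)))` is equal to `±1` and it is `+1` for almost all `v`».
[cite: Rogawski1990, §14.6 p. 242; §4.3 pp. 43–44] [cite: Kottwitz1986, §7] -/
theorem eventually_finKappaAt_rationalComponent_eq_one (hherm : (H'.map (cmConjRingHom L))ᵀ = H') (hdet : IsUnit H'.det)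
    (γH : (UnitaryGroup.cmDatum L 2 (Matrix.of fun i j : Fin 2 => if i.val + j.val + 1 = 2 then (1 : L) else 0)).Rational ×
      (UnitaryGroup.cmDatum L 1 (Matrix.of fun i j : Fin 1 => if i.val + j.val + 1 = 1 then (1 : L) else 0)).Rational)
    (γ : (UnitaryGroup.cmDatum L 3 H').Adelic)
    (hreg : IsGRegular (cmConjRingHom L) (Matrix.of fun i j : Fin 2 => if i.val + j.val + 1 = 2 then (1 : L) else 0)
        (Matrix.of fun i j : Fin 1 => if i.val + j.val + 1 = 1 then (1 : L) else 0)
        (Matrix.of fun i j : Fin 3 => if i.val + j.val + 1 = 3 then (1 : L) else 0) endoForm_antidiagOne γH)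
    (hmatch : ∀ v, IsLocalNormPair L H' v (rationalComponent L γH v) ((UnitaryGroup.cmDatum L 3 H').toLocal v γ)) :
    ∀ᶠ v : HeightOneSpectrum (𝓞 ↥(maximalRealSubfield L)) in cofinite,
      finKappaAt L v H' (rationalComponent L γH v) ((UnitaryGroup.cmDatum L 3 H').toLocal v γ) = 1 := by
  -- the global elements
  set g₀ : Matrix (Fin 2) (Fin 2) L := (γH.1.val.val : Matrix (Fin 2) (Fin 2) L) with hg₀
  set u₀ : L := (γH.2.val.val : Matrix (Fin 1) (Fin 1) L) 0 0 with hu₀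
  have hc₀ : (g₀.charpoly).eval u₀ ≠ 0 := eval_charpoly_gammaTwo_ne_zero_of_isGRegular L γH hreg
  -- (E1) unramified places
  have E1 : ∀ᶠ v : HeightOneSpectrum (𝓞 ↥(maximalRealSubfield L)) in cofinite, Algebra.IsUnramifiedIn (𝓞 L) v.asIdeal := by
    rw [Filter.eventually_cofinite]
    exact finite_setOf_not_isUnramifiedIn (↥(maximalRealSubfield L)) L
  -- (E2) the adelic `γ̄` is integral at almost every place
  have E2w : ∀ᶠ w : HeightOneSpectrum (𝓞 L) in cofinite,
      ∀ i j : Fin 3, ((((γ.val.val : Matrix (Fin 3) (Fin 3) (AdeleRing (𝓞 L) L)) i j).2 : FiniteAdeleRing (𝓞 L) L) w) ∈ w.adicCompletionIntegers L := by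
    simp only [Filter.eventually_all]
    exact fun i j => (((γ.val.val : Matrix (Fin 3) (Fin 3) (AdeleRing (𝓞 L) L)) i j).2).eventually
  have E2 := UnitaryGroup.eventually_forall_placesOver (F := ↥(maximalRealSubfield L)) L E2w
  -- (E3) `H′` and `H′⁻¹` are integral at almost every place
  have E3w : ∀ᶠ w : HeightOneSpectrum (𝓞 L) in cofinite, ∀ i j : Fin 3,
      Valued.v (algebraMap L (w.adicCompletion L) (H' i j)) ≤ 1 ∧ Valued.v (algebraMap L (w.adicCompletion L) (H'⁻¹ i j)) ≤ 1 := by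
    simp only [Filter.eventually_all, Filter.eventually_and]
    exact fun i j => ⟨eventually_valued_algebraMap_le_one' L (H' i j), eventually_valued_algebraMap_le_one' L (H'⁻¹ i j)⟩
  have E3 := UnitaryGroup.eventually_forall_placesOver (F := ↥(maximalRealSubfield L)) L E3w
  -- (E4) `tr g`, `det g` integral and `χ_g(u)` a unit at almost every place
  have E4w : ∀ᶠ w : HeightOneSpectrum (𝓞 L) in cofinite,
      Valued.v (algebraMap L (w.adicCompletion L) g₀.trace) ≤ 1 ∧ Valued.v (algebraMap L (w.adicCompletion L) g₀.det) ≤ 1 ∧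
        Valued.v (algebraMap L (w.adicCompletion L) ((g₀.charpoly).eval u₀)) = 1 :=
    (eventually_valued_algebraMap_le_one' L _).and ((eventually_valued_algebraMap_le_one' L _).and
      (UnitaryGroup.eventually_valued_algebraMap_eq_one L hc₀))
  have E4 := UnitaryGroup.eventually_forall_placesOver (F := ↥(maximalRealSubfield L)) L E4w
  filter_upwards [E1, E2, E3, E4] with v h1 h2 h3 h4
  by_cases hv : Subsingleton (UnitaryGroup.PlacesOver L v)
  · obtain ⟨w⟩ := (inferInstance : Nonempty (UnitaryGroup.PlacesOver L v))
    have hg : ((rationalComponent L γH v).1.val.val : Matrix (Fin 2) (Fin 2) (UnitaryGroup.LocalRing L v)) =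
        g₀.map (algebraMap L (UnitaryGroup.LocalRing L v)) := by
      unfold rationalComponent
      exact coe_coe_toLocal_toAdelic L v _ γH.1
    refine finKappaAt_eq_one_of_integral_nonsplit L v H' _ _ hv w h1 hherm hdet (hmatch v)
      (fun i j => (h3 w i j).1) (fun i j => (h3 w i j).2) (fun i j => ?_) ?_ ?_ ?_
    · rw [← HeightOneSpectrum.mem_adicCompletionIntegers]
      exact h2 w i j
    · rw [hg, trace_map_ringHom']
      exact (h4 w).1
    · rw [hg, det_map_ringHom']
      exact (h4 w).2.1
    · rw [finCharpolyTwo_rationalComponent, finGammaTwo_rationalComponent, Polynomial.eval_map, Polynomial.eval₂_hom]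
      exact (h4 w).2.2
  · exact finKappaAt_of_not_subsingleton L v H' _
      (finEigenlineProjector_ne_zero L v H' _ _ (hmatch v) (isLocalGRegular_rationalComponent L γH hreg v)) hv

/-- **N3 — THE EXPLICIT FINITE COLLECTION IS ALMOST EVERYWHERE TRIVIAL**: for `H′` hermitian and invertible, every Hecke character `μ` and any two
invariance witnesses `hl`, `hr`, `IsAlmostEverywhereTrivial L H′ (finExplicitCollection L H′ μ hl hr)` (★ `GlobalTransferFactor` :151: `Δ‴_v((γ_H)_v, γ̄_v)
= 1` for almost all `v`, for every rational `G`-regular `γ_H` and adelic matching `γ̄`) — ★ FILE A's reduction (`τ_v = 1`, `D_v = 1` a.e.) ∘ this file's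
`κ_v = 1` a.e.; the (A3)-triviality clause of the #72 letter ★ `GlobalTransferWithCartanKappaFormula` at `Δ := Δ‴`. [cite: Rogawski1990, §4.3 pp. 43–44; §14.6 p. 242] -/
theorem isAlmostEverywhereTrivial_finExplicitCollection (hherm : (H'.map (cmConjRingHom L))ᵀ = H') (hdet : IsUnit H'.det) (μ : HeckeCharacter L)
    (hl : ∀ (v : HeightOneSpectrum (𝓞 ↥(maximalRealSubfield L)))
      (a : (UnitaryGroup.cmDatum L 2 (Matrix.of fun i j : Fin 2 => if i.val + j.val + 1 = 2 then (1 : L) else 0)).Local v ×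
      (UnitaryGroup.cmDatum L 1 (Matrix.of fun i j : Fin 1 => if i.val + j.val + 1 = 1 then (1 : L) else 0)).Local v)
      (b : (UnitaryGroup.cmDatum L 3 H').Local v)
      (x : (UnitaryGroup.cmDatum L 2 (Matrix.of fun i j : Fin 2 => if i.val + j.val + 1 = 2 then (1 : L) else 0)).Local v ×
      (UnitaryGroup.cmDatum L 1 (Matrix.of fun i j : Fin 1 => if i.val + j.val + 1 = 1 then (1 : L) else 0)).Local v),
      finExplicitDelta L v H' (x * a * x⁻¹) μ b = finExplicitDelta L v H' a μ b)
    (hr : ∀ (v : HeightOneSpectrum (𝓞 ↥(maximalRealSubfield L)))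
      (a : (UnitaryGroup.cmDatum L 2 (Matrix.of fun i j : Fin 2 => if i.val + j.val + 1 = 2 then (1 : L) else 0)).Local v ×
      (UnitaryGroup.cmDatum L 1 (Matrix.of fun i j : Fin 1 => if i.val + j.val + 1 = 1 then (1 : L) else 0)).Local v)
      (b y : (UnitaryGroup.cmDatum L 3 H').Local v),
      finExplicitDelta L v H' a μ (y * b * y⁻¹) = finExplicitDelta L v H' a μ b) :
    IsAlmostEverywhereTrivial L H' (finExplicitCollection L H' μ hl hr) :=
  isAlmostEverywhereTrivial_finExplicitCollection_of_eventually_finKappaAt L H' μ hl hr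
    fun γH γ hreg hmatch => eventually_finKappaAt_rationalComponent_eq_one L H' hherm hdet γH γ hreg hmatch

/-- **N3 at print's unconditional collection**: `IsAlmostEverywhereTrivial L H′ (finExplicitCollection L H′ μ (finExplicitDelta_conj_left_all …) (finExplicitDelta_conj_right_all …))`
— the term at which the T6-L3 pay-down line instantiates the #72 letter's `Δ` slot. [cite: Rogawski1990, §4.3 pp. 43–44; §14.6 p. 242] -/
theorem isAlmostEverywhereTrivial_finExplicitCollection_canonical (hherm : (H'.map (cmConjRingHom L))ᵀ = H') (hdet : IsUnit H'.det)
    (μ : HeckeCharacter L) :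
    IsAlmostEverywhereTrivial L H' (finExplicitCollection L H' μ (finExplicitDelta_conj_left_all L H' μ) (finExplicitDelta_conj_right_all L H' μ)) :=
  isAlmostEverywhereTrivial_finExplicitCollection L H' hherm hdet μ _ _

end Global



end Literature.NumberTheory.Rogawski1990

end
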